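import Literature.NumberTheory.EllipticCurves.Sprung2012.ColemanPairExistsProofs
import Literature.NumberTheory.EllipticCurves.Sprung2012.ColemanTwistProofs
import Literature.NumberTheory.EllipticCurves.Sprung2012.ColemanMapLambdaActionProofs
import Literature.NumberTheory.EllipticCurves.Sprung2024.ChromaticSmallControlSurjProofs
import Literature.Algebra.Module.PadicFunctionalSeparation
import HarnessLib

/-!
# The ♭ Coleman kernel under EXPLICIT Honda clauses (any `p`, any base) — the `p = 2` port, part 1

Seat `bsd-2adic-ss-1` GEN 10, crux `SupersingularRankZeroAtTwo` (item stmt-BirchSwinnertonDyer-19097,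
route `ByReductionTypeAtTwo`, rung K4), line `signed_halves_two` v8 stub (5) `stub_pmFlatData`
(the ♭ Coleman road at `2` on the `a₂ = ±2` sub-row; `Theorems/…SupersingularFlatRoad*.lean`, GEN 9).

WHY. Since GEN 9 the K3 lane landed KERNEL theorems for F. Sprung, Adv. Math. 449 (2024) §5.2
(the ♯/♭ `Γ`-Euler characteristic: `Sprung2024/Chromatic{EulerCharAssembly,LocalInjectivity,
SmallControlSurj,CharValueRankZero}Proofs`, `Sprung2012/{ColemanMapSurjective,ColemanTwist,
ColemanPairExists,LocalTowerNoPTorsion}Proofs`), all typed at `p ≠ 2` because they consume the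
ODD-`p` Honda predicate `Sprung2012.IsHondaSystem` (bottom relations `c_0 = (a_p − 2)c_{−1}`,
`Tr_{1/0} c_1 = a_p c_0 − (p−1) c_{−1}`, generation of `F_ss(𝔪_{−1})` by `c_{−1}`; its docstring:
"TODO(general form): `p = 2`"). At `p = 2` Sprung's Theorem 2.2 has the shifted tower `N = n + 2` and
the bottom relation (2′); traced to the `ℤ₂`-tower (`d_n := Tr_Δ c_n`) the relations read
`Tr_{n+1/n} d_{n+1} = a₂ d_n − d_{n−1}` (`n ≥ 1`) and `d_0 = [−c♭]ε` with `c♭ = −a₂² + 2a₂ + 1 ∈ {1, −7}`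
a `2`-adic UNIT, `ε` a generator of `Ê(ℚ₂)` (seat memo `ss/evidence/MEMO-F1flat-gen9.md`, audit-1 sheet
a7f89bf8: Sprung's own table p. 1498). So at `2` the level-`0` generation clause holds ON `c 0 = d_0`
itself, and `c_{−1}` plays no role for the colour ♭ (whose Coleman value is read at level `0`:
`L♭ ≡ −z(c_0) (mod T)`, Def. 7.2). This file re-proves the ♭ half of the K3 lane's Coleman-kernel
algebra with the Honda clauses it actually uses as EXPLICIT HYPOTHESES — levels `c n ∈ E(K_n·K_v)`,
the trace relation for `n ≥ 1`, and (where needed) the level-`0` generation clause on `c 0` — for ANY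
prime `p`, any base field and any `ap` with `p ∣ ap`; no `IsHondaSystem`, no `p ≠ 2`. Proof bodies are
adapted line by line from the cited tree files (K3 lane, seats `bsd-ssimc-k3c5-kdot-split`,
`bsd-littype-11`, `bsd-cited-r18`); the mathematics is Sprung 2012 Def. 3.1 / 5.9 / 7.1–7.2 / 7.9,
Props. 3.9, 5.3–5.7, 7.3 and Sprung 2024 §5.2 p. 40.

CONTENTS (namespace `Summit.BirchSwinnertonDyer.BirchSwinnertonDyer.Theorems.SSFlatEC`; `K` any field,
`K_v = E` any extension, `κ` any `ℤ_p`-extension, `ι : K̄ → K̄_v`, `W/K`):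
* `isQueueSequence_colemanTheta_of_trace`, `exists_isColemanPair_of_trace` — every functional on
  `E(K_∞·K_v)` has a Coleman value, from the levels and the `n ≥ 1` trace relation only
  (Props. 3.9/5.3/5.5/5.7 via `Sprung2017.IsQueueSequence.exists_isChromaticLimit`);
* `constantCoeff_flat_eq_neg_apply` — `L♭(z)(0) = −z(c_0)` (Def. 7.2 `Col♭_0 = −P¹_0`);
* `apply_layer_zero_eq_zero_of_mem_colemanKer_flat` — `Ker Col♭` kills `E(K_v)`, from the level-`0`
  generation clause on `c 0`;
* `exists_mem_colemanKer_flat_add_twist` — a functional killing `E(K_v)` is `z₁ + (w∘g⁻¹ − w)` with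
  `z₁ ∈ Ker Col♭`, given `Col♭` onto (dual of "`(ker Col♭)_X → ker Col♭_0` onto", Sprung 2024 p. 40);
* `isUnit_flat_of_not_dvd_apply`, `flat_surjective_of_isUnit` — `Col♭(z₀) ∈ Λˣ` iff `p ∤ z₀(c_0)`,
  and then `Col♭` is onto `Λ` (Prop. 7.3's mechanism, `Λ`-linearity `IsColemanPair.exists_mul`);
* `exists_not_dvd_apply_czero` — such a `z₀` exists, from: no `p`-torsion in `E(K_∞·K_v)`, the
  level-`0` generation clause on `c 0` (injective + `p`-saturated), and ONE functional of `E(K_v)` with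
  a value prime to `p`.
HONEST FRAMING: kernel algebra on the tree's transcription of Sprung's objects; hypotheses displayed;
nothing about any curve is asserted; no census cell moves; BSD is not proved by any of this.

References: [Sprung2012] F. Sprung, J. Number Theory 132 (2012) 1483–1506, Thm. 2.2 + (2′) (p. 1487),
Def. 3.1, Prop. 3.9, Props. 5.3–5.7, Def. 5.9, Def. 7.1–7.2, Prop. 7.3, Def. 7.9; [Sprung2024]
F. Sprung, Adv. Math. 449 (2024) 109741, §5.2 p. 40; [Sprung2017] ANT 11 (2017) Cor. 4.4.
-/

set_option autoImplicit false
-- the Theorems namespace of this sub repeats the summit name by design (D-0017 nested layout)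
set_option linter.dupNamespace false

noncomputable section

open scoped Classical NumberField

open NumberField IsDedekindDomain Polynomial WeierstrassCurve Literature.NumberTheory.EllipticCurves
  Literature.NumberTheory.GaloisRepresentations Literature.NumberTheory.EllipticCurves.ZpExtension
  Literature.NumberTheory.EllipticCurves.Kobayashi2003 Literature.NumberTheory.EllipticCurves.Sprung2017
  Literature.NumberTheory.EllipticCurves.Sprung2012

universe u

namespace Summit.BirchSwinnertonDyer.BirchSwinnertonDyer.Theorems.SSFlatEC

variable {K : Type u} [Field K] {p : ℕ} [Fact p.Prime] (κ : ZpExtension K p)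
variable {E : Type u} [Field E] [Algebra K E] (ι : AlgebraicClosure K →ₐ[K] AlgebraicClosure E)
variable (W : WeierstrassCurve K)

/-! ## §1 Coleman values from the levels and the `n ≥ 1` trace relation -/

/-- **`(P_{n,c_n}(z))_n` is an integral queue sequence** from the levels `c_n ∈ E(K_n·K_v)` and the
trace relation `Tr_{n+2/n+1} c_{n+2} = a_p c_{n+1} − c_n` (`n + 1 ≥ 1`) ALONE — the body of
`Sprung2012.isQueueSequence_colemanTheta` with the Honda predicate replaced by the two clauses it uses
(valid at every `p`, in particular for the traced `p = 2` system of Thm. 2.2 (2′)).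
[cite: Sprung2012, Thm. 2.2 (1) (p. 1487) and Prop. 5.5 (p. 1494)] [cite: Sprung2017, Def. 1.7] -/
theorem isQueueSequence_colemanTheta_of_trace {g : Field.absoluteGaloisGroup E}
    (hg : κ.IsTopGenerator (resGalOfEmb ι g)) {ap : ℤ} {c : ℕ → localPoints W E}
    (hc : ∀ n, c n ∈ localLayerPointsOfEmb κ ι W n)
    (hTr : ∀ n, 1 ≤ n → localTraceOfEmb κ ι W n (n + 1) (c (n + 1)) = ap • c n - c (n - 1))
    (z : localTowerPointsOfEmb κ ι W →+ ℤ_[p]) :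
    IsQueueSequence p ap (colemanTheta κ ι W g c z) := by
  intro n
  have hcT : ∀ k, c k ∈ localTowerPointsOfEmb κ ι W := fun k =>
    localLayerPointsOfEmb_le_localTowerPointsOfEmb κ ι W _ (hc k)
  have htr : localTraceOfEmb κ ι W (n + 1) (n + 2) (c (n + 2)) = ap • c (n + 1) - c n := by
    have h := hTr (n + 1) (Nat.le_add_left 1 n)
    simpa only [Nat.add_sub_cancel] using h
  obtain ⟨q, hq⟩ := omega_dvd_thetaPoly_succ_sub κ ι W hg (hc (n + 2)) z
  refine ⟨q, ?_⟩
  rw [colemanTheta_eq_thetaPoly, colemanTheta_eq_thetaPoly, colemanTheta_eq_thetaPoly,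
    ← thetaPoly_succ_of_mem_layer κ ι W hg (hc n), ← thetaPoly_zsmul κ ι W g (n + 1) (hcT (n + 1)),
    sub_add, ← thetaPoly_sub κ ι W g (n + 1) (zsmul_mem (hcT (n + 1)) ap) (hcT n), ← htr]
  exact hq

/-- **Every functional has a Coleman value** (Sprung 2012 Props. 3.9 / 5.3 / 5.5 / 5.7, Def. 5.9) from
`p ∣ a_p`, a local lift `g` of the generator, the levels and the `n ≥ 1` trace relation — the body of
`Sprung2012.exists_isColemanPair` without the Honda predicate; any `p`.
[cite: Sprung2012, Prop. 3.9 (p. 1491), Prop. 5.3 and Def. 5.9 (pp. 1493–1495)] [cite: Sprung2017, Thm. 1.12] -/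
theorem exists_isColemanPair_of_trace {g : Field.absoluteGaloisGroup E}
    (hg : κ.IsTopGenerator (resGalOfEmb ι g)) {ap : ℤ} (hap : (p : ℤ) ∣ ap)
    {c : ℕ → localPoints W E} (hc : ∀ n, c n ∈ localLayerPointsOfEmb κ ι W n)
    (hTr : ∀ n, 1 ≤ n → localTraceOfEmb κ ι W n (n + 1) (c (n + 1)) = ap • c n - c (n - 1))
    (z : localTowerPointsOfEmb κ ι W →+ ℤ_[p]) :
    ∃ Lsharp Lflat : IwasawaAlgebra p, IsColemanPair κ ι W ap g c z Lsharp Lflat := by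
  obtain ⟨Cs, Cf, h⟩ :=
    (isQueueSequence_colemanTheta_of_trace κ ι W hg hc hTr z).exists_isChromaticLimit hap
  refine ⟨Cs, Cf, fun m => ?_⟩
  obtain ⟨Q, hQ⟩ := h m
  refine ⟨Q, ?_⟩
  rw [← coe_colemanTheta]
  exact hQ

/-! ## §2 Level `0` of the Coleman characterisation: `L♭(z)(0) = −z(c_0)` -/

variable {κ ι W}

/-- **`L♭(z)(0) = −z(c_0)`** — level `0` of `IsColemanPair` (Def. 7.2: `Col♭_0 = −P¹_0`; in the
transcription `T ∣ z(c_0) + 0·L♯ + 1·L♭`, `u_0 = 0`, `v_0 = 1`). Any `p`, any data.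
[cite: Sprung2012, Def. 7.2 (p. 1500) and Def. 5.9 (p. 1495)] -/
theorem constantCoeff_flat_eq_neg_apply {ap : ℤ} {g : Field.absoluteGaloisGroup E}
    {c : ℕ → localPoints W E} {z : localTowerPointsOfEmb κ ι W →+ ℤ_[p]} {Ls Lf : IwasawaAlgebra p}
    (hCP : IsColemanPair κ ι W ap g c z Ls Lf) (hc0 : c 0 ∈ localTowerPointsOfEmb κ ι W) :
    PowerSeries.constantCoeff Lf = -z ⟨c 0, hc0⟩ := by
  have h := hCP 0
  rw [sharpPoly_zero, flatPoly_zero, map_zero, map_one, zero_mul, one_mul, zero_add] at h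
  have h' := constantCoeff_eq_zero_of_toIwasawa_cyclotomicOmega_dvd h
  rw [map_add, constantCoeff_pairingSum] at h'
  simp only [pow_zero, Finset.sum_range_one, one_smul] at h'
  rw [evalOn_of_mem W _ z hc0] at h'
  exact eq_neg_of_add_eq_zero_right h'

/-- **`Ker Col♭` kills the bottom layer `E(K_v) = E(K_0·K_v)`** given the level-`0` generation clause
ON `c 0` ("evaluation at `c_0` is injective on `Hom(E(K_v), ℤ_p)`" — at `p = 2`: `d_0 = [−c♭]ε`
generates `Ê(ℚ₂)` and `E(ℚ₂)/Ê` has odd order): for `z ∈ Ker Col♭`, `L♭(z) = 0`, so `z(c_0) = 0`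
(`constantCoeff_flat_eq_neg_apply`), so `z|_{E(K_v)} = 0`. The ♭ half of
`Sprung2012.colemanKer_apply_eq_zero_of_mem_localLayerPointsOfEmb_zero` without `p ≠ 2`.
[cite: Sprung2024, §5.2 p. 39 (E♭_{0,p} = E(ℚ_p) ⊗ ℚ_p/ℤ_p)] [cite: Sprung2012, Def. 7.2 (p. 1500), Thm. 2.2 (p. 1487)] -/
theorem apply_layer_zero_eq_zero_of_mem_colemanKer_flat {ap : ℤ} {g : Field.absoluteGaloisGroup E}
    {c : ℕ → localPoints W E} (hc0 : c 0 ∈ localLayerPointsOfEmb κ ι W 0)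
    (hgen0 : ∀ z₀ : localLayerPointsOfEmb κ ι W 0 →+ ℤ_[p],
      evalOn W (localLayerPointsOfEmb κ ι W 0) z₀ (c 0) = 0 → z₀ = 0)
    {z : localTowerPointsOfEmb κ ι W →+ ℤ_[p]} (hz : z ∈ colemanKer κ ι W ap g c Chroma.flat)
    {x : localPoints W E} (hx : x ∈ localLayerPointsOfEmb κ ι W 0) :
    z ⟨x, localLayerPointsOfEmb_le_localTowerPointsOfEmb κ ι W 0 hx⟩ = 0 := by
  obtain ⟨Ls, Lf, hCP, hcol⟩ := hz
  have hle := fun n ↦ localLayerPointsOfEmb_le_localTowerPointsOfEmb κ ι W n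
  rw [chromaticL_flat] at hcol
  have hzc0 : z ⟨c 0, hle 0 hc0⟩ = 0 := by
    have h := constantCoeff_flat_eq_neg_apply hCP (hle 0 hc0)
    rw [hcol, map_zero] at h
    exact (neg_eq_zero.mp h.symm)
  let z₀ : localLayerPointsOfEmb κ ι W 0 →+ ℤ_[p] := z.comp (AddSubgroup.inclusion (hle 0))
  have hz₀ : z₀ = 0 := hgen0 z₀ (by
    rw [evalOn_of_mem W _ z₀ hc0]
    exact hzc0)
  have hzx := DFunLike.congr_fun hz₀ ⟨x, hx⟩
  rw [AddMonoidHom.zero_apply] at hzx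
  exact hzx

/-! ## §3 `Ann(E(K_v)) ⊆ Ker Col♭ + (γ − 1)·H¹_Iw` from the surjectivity of `Col♭` -/

/-- **A functional vanishing on `E(K_v)` is `z₁ + (w ∘ g⁻¹ − w)` with `z₁ ∈ Ker Col♭`, provided `Col♭`
is onto `Λ`** — the ♭ half of `Sprung2012.exists_mem_colemanKer_add_twist_of_apply_layer_zero` with the
Honda predicate replaced by the levels + `n ≥ 1` relation (the Coleman value of `z` exists,
`exists_isColemanPair_of_trace`; `L♭(z)(0) = −z(c_0) = 0` so `L♭(z) = T·f`; `f = Col♭(w)`;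
`w∘g⁻¹ − w` has Coleman pair `T·Col(w)`), any `p`. The surjectivity `hsurj` is displayed ("every `f`
is `Col♭` of some functional", Prop. 7.3's conclusion shape).
[cite: Sprung2024, §5.2 proof of Lemma 5.5, case v = p (p. 40)] [cite: Sprung2012, Prop. 7.3 (p. 1500)] -/
theorem exists_mem_colemanKer_flat_add_twist {ap : ℤ} (hap : (p : ℤ) ∣ ap)
    {g : Field.absoluteGaloisGroup E} (hg : κ.IsTopGenerator (resGalOfEmb ι g))
    {c : ℕ → localPoints W E} (hc : ∀ n, c n ∈ localLayerPointsOfEmb κ ι W n)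
    (hTr : ∀ n, 1 ≤ n → localTraceOfEmb κ ι W n (n + 1) (c (n + 1)) = ap • c n - c (n - 1))
    (hsurj : ∀ f : IwasawaAlgebra p, ∃ (w : localTowerPointsOfEmb κ ι W →+ ℤ_[p])
      (Ls : IwasawaAlgebra p), IsColemanPair κ ι W ap g c w Ls f)
    {z : localTowerPointsOfEmb κ ι W →+ ℤ_[p]}
    (hz0 : ∀ (x : localPoints W E) (hx : x ∈ localLayerPointsOfEmb κ ι W 0),
      z ⟨x, localLayerPointsOfEmb_le_localTowerPointsOfEmb κ ι W 0 hx⟩ = 0) :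
    ∃ (z₁ w : localTowerPointsOfEmb κ ι W →+ ℤ_[p]), z₁ ∈ colemanKer κ ι W ap g c Chroma.flat ∧
      ∀ y : localTowerPointsOfEmb κ ι W, z y = z₁ y +
        (w ⟨g⁻¹ • (y : localPoints W E), smul_mem_localTowerPointsOfEmb κ ι W g⁻¹ y.2⟩ - w y) := by
  have hle := fun n ↦ localLayerPointsOfEmb_le_localTowerPointsOfEmb κ ι W n
  obtain ⟨Ls, Lf, hCP⟩ := exists_isColemanPair_of_trace κ ι W hg hap hc hTr z
  have hf0 : PowerSeries.constantCoeff Lf = 0 := by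
    rw [constantCoeff_flat_eq_neg_apply hCP (hle 0 (hc 0)), hz0 _ (hc 0), neg_zero]
  obtain ⟨f, hf⟩ := PowerSeries.X_dvd_iff.mpr hf0
  obtain ⟨w, Ls', hw⟩ := hsurj f
  obtain ⟨w', hw'⟩ := exists_twist κ ι W g w
  have hδ : IsColemanPair κ ι W ap g c (w' - w) (PowerSeries.X * Ls') (PowerSeries.X * f) :=
    hw.twist_sub κ ι W hg hc hw'
  have hz₁ : IsColemanPair κ ι W ap g c (z - (w' - w)) (Ls - PowerSeries.X * Ls')
      (Lf - PowerSeries.X * f) := hCP.sub hδ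
  refine ⟨z - (w' - w), w, ⟨_, _, hz₁, ?_⟩, fun y ↦ ?_⟩
  · rw [chromaticL_flat, hf, sub_self]
  · rw [AddMonoidHom.sub_apply, AddMonoidHom.sub_apply, hw' y, sub_add_cancel]

/-! ## §4 `Col♭` onto `Λ` from one functional with `p ∤ z₀(c_0)` -/

/-- An element of `ℤ_p` divisible by every power of `p` is `0`. [folklore] -/
theorem padicInt_eq_zero_of_forall_pow_dvd {a : ℤ_[p]} (h : ∀ k : ℕ, (p : ℤ_[p]) ^ k ∣ a) : a = 0 := by
  by_contra hx
  have := (PadicInt.mem_span_pow_iff_le_valuation a hx (a.valuation + 1)).mp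
    (Ideal.mem_span_singleton.mpr (h _))
  omega

/-- `IsUnit a ↔ p ∤ a` in `ℤ_p`. [folklore] -/
theorem padicInt_isUnit_iff_not_dvd {a : ℤ_[p]} : IsUnit a ↔ ¬ (p : ℤ_[p]) ∣ a := by
  rw [PadicInt.isUnit_iff, ← PadicInt.norm_lt_one_iff_dvd, not_lt, le_antisymm_iff,
    and_iff_right (PadicInt.norm_le_one a)]

/-- **`Col♭(z₀) ∈ Λˣ` when `p ∤ z₀(c_0)`**: `L♭(0) = −z₀(c_0)` is a `p`-adic unit (Def. 7.2; any `p` —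
at odd `p` this is `Sprung2012.IsColemanPair.isUnit_of_not_dvd` read through `c_0 = (a_p−2)c_{−1}`, at
`p = 2` it is used directly on `c_0 = d_0`). [cite: Sprung2012, Def. 7.2 and proof of Prop. 7.3 (p. 1500)] -/
theorem isUnit_flat_of_not_dvd_apply {ap : ℤ} {g : Field.absoluteGaloisGroup E}
    {c : ℕ → localPoints W E} {z : localTowerPointsOfEmb κ ι W →+ ℤ_[p]} {Ls Lf : IwasawaAlgebra p}
    (hCP : IsColemanPair κ ι W ap g c z Ls Lf) (hc0 : c 0 ∈ localTowerPointsOfEmb κ ι W)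
    (hz : ¬ (p : ℤ_[p]) ∣ z ⟨c 0, hc0⟩) : IsUnit Lf := by
  refine PowerSeries.isUnit_iff_constantCoeff.mpr ?_
  rw [constantCoeff_flat_eq_neg_apply hCP hc0, IsUnit.neg_iff, padicInt_isUnit_iff_not_dvd]
  exact hz

/-- **`Col♭` is onto `Λ` as soon as ONE functional has a unit ♭-value** (`Λ`-linearity of `Col`,
`Sprung2012.IsColemanPair.exists_mul`: `z = (f·L♭₀⁻¹)•z₀`). The mechanism of the proof of Prop. 7.3, any
`p`. [cite: Sprung2012, Prop. 7.3 (p. 1500) and Def. 5.9 (p. 1495)] -/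
theorem flat_surjective_of_isUnit {ap : ℤ} {g : Field.absoluteGaloisGroup E}
    (hg : κ.IsTopGenerator (resGalOfEmb ι g)) {c : ℕ → localPoints W E}
    (hc : ∀ n, c n ∈ localLayerPointsOfEmb κ ι W n)
    {z₀ : localTowerPointsOfEmb κ ι W →+ ℤ_[p]} {Ls₀ Lf₀ : IwasawaAlgebra p}
    (h0 : IsColemanPair κ ι W ap g c z₀ Ls₀ Lf₀) (hu : IsUnit Lf₀) (f : IwasawaAlgebra p) :
    ∃ (z : localTowerPointsOfEmb κ ι W →+ ℤ_[p]) (Ls : IwasawaAlgebra p),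
      IsColemanPair κ ι W ap g c z Ls f := by
  obtain ⟨u, rfl⟩ := hu
  obtain ⟨z, hz⟩ := h0.exists_mul hg hc (f * ↑u⁻¹)
  refine ⟨z, f * ↑u⁻¹ * Ls₀, ?_⟩
  rwa [Units.inv_mul_cancel_right] at hz

/-! ## §5 A functional with `p ∤ z₀(c_0)` from the level-`0` generation clause on `c_0` -/

variable (κ ι W) in
/-- **A functional `z₀` on `E(K_∞·K_v)` with `p ∤ z₀(c_0)` exists**, from: (i) no `p`-torsion in
`E(K_∞·K_v)` (Lemma 2.3, displayed), (ii) the level-`0` generation clause ON `c_0` — evaluation at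
`c_0` is injective on `Hom(E(K_v), ℤ_p)` with `p`-saturated image (at `p = 2`: `c_0 = d_0 = [−c♭]ε`) —
and (iii) SOME functional of `E(K_v)` with a value prime to `p` (`E(K_v) ≠ p·E(K_v)`). The body of
`Sprung2012.exists_addMonoidHom_not_dvd_apply_cneg` with `c_{−1} ↦ c_0` and `p ≠ 2 ↦ (i)`: were every
functional divisible by `p` at `c_0`, Pontryagin separation on the torsion-free tower would put
`c_0 ∈ p·E(K_∞·K_v)`, hence (saturation of `E(K_v)` in the tower) in `p·E(K_v)`, so every functional of
`E(K_v)` would be divisible at `c_0` by every `p^k`, hence vanish there, hence be `0` — contradicting (iii).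
[cite: Sprung2012, proof of Prop. 7.3 (p. 1500), Thm. 2.2 (p. 1487), Lemma 2.3 (p. 1487), Lemma 7.4 (p. 1500)] -/
theorem exists_not_dvd_apply_czero
    (hnt : ∀ P ∈ localTowerPointsOfEmb κ ι W, p • P = 0 → P = 0)
    {c : ℕ → localPoints W E} (hc0 : c 0 ∈ localLayerPointsOfEmb κ ι W 0)
    (hinj : ∀ z₀ : localLayerPointsOfEmb κ ι W 0 →+ ℤ_[p],
      evalOn W (localLayerPointsOfEmb κ ι W 0) z₀ (c 0) = 0 → z₀ = 0)
    (hsat : ∀ a : ℤ_[p], (∃ z₀ : localLayerPointsOfEmb κ ι W 0 →+ ℤ_[p],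
        evalOn W (localLayerPointsOfEmb κ ι W 0) z₀ (c 0) = p * a) →
      ∃ y : localLayerPointsOfEmb κ ι W 0 →+ ℤ_[p], evalOn W (localLayerPointsOfEmb κ ι W 0) y (c 0) = a)
    (hex : ∃ (z : localLayerPointsOfEmb κ ι W 0 →+ ℤ_[p]) (x : localLayerPointsOfEmb κ ι W 0),
      ¬ (p : ℤ_[p]) ∣ z x) :
    ∃ z₀ : localTowerPointsOfEmb κ ι W →+ ℤ_[p],
      ¬ (p : ℤ_[p]) ∣ z₀ ⟨c 0, localLayerPointsOfEmb_le_localTowerPointsOfEmb κ ι W 0 hc0⟩ := by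
  have hle := fun n ↦ localLayerPointsOfEmb_le_localTowerPointsOfEmb κ ι W n
  by_contra hall
  push Not at hall
  -- the tower has no `p`-torsion, so `c_0 ∈ p·E(K_∞·K_v)`
  have hN : ∀ y : localTowerPointsOfEmb κ ι W, p • y = 0 → y = 0 := fun y hy ↦ by
    apply Subtype.ext
    exact hnt _ y.2 (by rw [← AddSubgroupClass.coe_nsmul, hy]; rfl)
  obtain ⟨y, hy⟩ := Literature.Algebra.Module.exists_nsmul_eq_of_forall_addMonoidHom_padicInt_dvd hN
    (k := 1) (n := ⟨c 0, hle 0 hc0⟩) (fun z ↦ by rw [pow_one]; exact hall z)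
  rw [pow_one] at hy
  have hy' : p ^ 1 • (y : localPoints W E) = c 0 := by
    rw [pow_one, ← AddSubgroupClass.coe_nsmul, hy]
  -- hence `c_0 ∈ p·E(K_v)` (the bottom layer is `p`-saturated in the tower)
  have hy0 : (y : localPoints W E) ∈ localLayerPointsOfEmb κ ι W 0 :=
    mem_localLayerPointsOfEmb_of_pow_nsmul_mem κ ι W hnt y.2 (by rw [hy']; exact hc0)
  -- every functional of `E(K_v)` is divisible by `p` at `c_0` …
  have hdiv : ∀ z' : localLayerPointsOfEmb κ ι W 0 →+ ℤ_[p],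
      (p : ℤ_[p]) ∣ evalOn W _ z' (c 0) := by
    intro z'
    rw [evalOn_of_mem W _ z' hc0]
    have e : (⟨c 0, hc0⟩ : localLayerPointsOfEmb κ ι W 0) = p • ⟨(y : localPoints W E), hy0⟩ := by
      apply Subtype.ext
      rw [AddSubgroupClass.coe_nsmul]
      change c 0 = p • (y : localPoints W E)
      rw [← hy', pow_one]
    rw [e, map_nsmul, nsmul_eq_mul]
    exact dvd_mul_right _ _
  -- … hence by every power of `p` (saturation clause) …
  have hpow : ∀ (k : ℕ) (z' : localLayerPointsOfEmb κ ι W 0 →+ ℤ_[p]),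
      (p : ℤ_[p]) ^ k ∣ evalOn W _ z' (c 0) := by
    intro k
    induction k with
    | zero => intro z'; rw [pow_zero]; exact one_dvd _
    | succ k ih =>
      intro z'
      obtain ⟨a, ha⟩ := hdiv z'
      obtain ⟨y', hy'⟩ := hsat a ⟨z', ha⟩
      obtain ⟨d, hd⟩ := ih y'
      rw [ha, ← hy', hd, pow_succ']
      exact ⟨d, by ring⟩
  -- … hence vanishes there, hence is `0` (injectivity clause): contradiction with (iii)
  have hzero : ∀ z' : localLayerPointsOfEmb κ ι W 0 →+ ℤ_[p], z' = 0 := fun z' ↦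
    hinj z' (padicInt_eq_zero_of_forall_pow_dvd fun k ↦ hpow k z')
  obtain ⟨z', x, hzx⟩ := hex
  exact hzx (by rw [hzero z', AddMonoidHom.zero_apply]; exact dvd_zero _)

end Summit.BirchSwinnertonDyer.BirchSwinnertonDyer.Theorems.SSFlatEC

end
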